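import Literature.Computability.Cryptography.OracleGames
import Literature.Computability.Cryptography.Indistinguishability
import HarnessLib

/-!
# The `RandAlg` shadow of an oracle adversary: transporting finite-probability analyses to the relativised setting

The tree's security reductions are analysed for distinguishers `D : RandAlg (List Bool) Bool`
(`Complexity/Randomized.lean`: a bare pair `(run, coinLen)` — a total run function on
`(input, coins)` and a coin count per input length, WITHOUT any efficiency clause), and the whole
finite-probability layer speaks that language: `acceptPMF`, `distAdvantage`
(`Indistinguishability.lean`), the hybrid identities of `PRGStretch`, the Goldreich–Levin counting
lemmas `GLEns.advantage_mul_eq`, `GLPred.inverter_count`, `GLInv.card_success_ge`, … . A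
relativised reduction faces a PPT ORACLE adversary `M` (`OracleGames.lean`) with a fixed oracle
`O`; since efficiency plays no role in those lemmas, they apply verbatim to the **shadow**

  `M.shadow O : RandAlg (List Bool) Bool`, `run w r = [out_M^O(w; r) = some 1]`, `coinLen = M.coins`,

whose output law is that of `M^O` read through "`some true ↦ true`, everything else (including a
run without output) `↦ false`" (`outputPMF_shadow`, `outputPMF_shadow_apply_true`). Consequently
`acceptPMF (M.shadow O) n X true = Pr_{s←X}[M^O⟨1ⁿ, s⟩ = 1]` (`acceptPMF_shadow_true`) and
`distAdvantage (M.shadow O) X Y n` is `M^O`'s distinguishing gap at level `n`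
(`distAdvantage_shadow`). This is the first brick of the relativised, per-length Goldreich–Levin
theorem (port of `GoldreichLevinInverter.lean`/`GoldreichLevinFinal.lean` to oracle distinguishers).

## References

* O. Goldreich, *Foundations of Cryptography I*, CUP 2001, Def. 3.2.2 (distinguishing gap), §3.6
  Def. 3.6.4 (PPT oracle machines: `Pr[M^F(1ⁿ) = 1]`).
* S. Arora, B. Barak, *Computational Complexity: A Modern Approach*, CUP 2009, Def. 7.1 with §3.4.
* J. Håstad, R. Impagliazzo, L. A. Levin, M. Luby, SIAM J. Comput. 28 (1999), Def. 3.6.1 (reductions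
  via oracle machines `M^{(A)}`: the adversary `A` enters only as a function).
-/

noncomputable section

namespace Literature.Computability.Cryptography

open _root_.Computability Complexity

namespace OracleAdversary

/-- **The `RandAlg` shadow of a Boolean oracle adversary with a fixed oracle**: the run function is the
indicator that the deterministic run of `M` with oracle `O` on `⟨w, r⟩` (within its round budget at
`|w|`) outputs `some true`; the coin count is `M`'s coin polynomial. No efficiency is claimed or
needed: the shadow only feeds finite-probability lemmas stated for `RandAlg`.
[cite: Goldreich2001, §3.6 Def. 3.6.4 (Pr[M^F(·) = 1])] -/
def shadow (M : OracleAdversary Bool) (O : Oracle) : RandAlg (List Bool) Bool where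
  run w r := decide (M.alg.run O (M.fuel.eval w.length) (boolPair w r) = some true)
  coinLen L := M.coins.eval L

/-- The run function of the shadow (definitional). [folklore] -/
@[simp] theorem shadow_run (M : OracleAdversary Bool) (O : Oracle) (w r : List Bool) :
    (M.shadow O).run w r = decide (M.alg.run O (M.fuel.eval w.length) (boolPair w r) = some true) := rfl

/-- The coin count of the shadow (definitional). [folklore] -/
@[simp] theorem shadow_coinLen (M : OracleAdversary Bool) (O : Oracle) (L : ℕ) :
    (M.shadow O).coinLen L = M.coins.eval L := rfl

/-- **The output law of the shadow is `M^O`'s output law read through `(· = some true)`.**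
[cite: AroraBarakCC2009, Def. 7.1 with §3.4] -/
theorem outputPMF_shadow (M : OracleAdversary Bool) (O : Oracle) (w : List Bool) :
    (M.shadow O).outputPMF id w = (M.outputPMF O w).map fun o => decide (o = some true) := by
  rw [RandAlg.outputPMF, outputPMF_eq_map, PMF.map_comp]
  rfl

/-- **`Pr[shadow = 1] = Pr[M^O = some 1]`.** [cite: Goldreich2001, §3.6 Def. 3.6.4] -/
theorem outputPMF_shadow_apply_true (M : OracleAdversary Bool) (O : Oracle) (w : List Bool) :
    (M.shadow O).outputPMF id w true = M.outputPMF O w (some true) := by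
  classical
  rw [outputPMF_shadow, PMF.map_apply]
  rw [tsum_eq_single (some true)]
  · simp
  · intro o ho
    have : decide (o = some true) = false := decide_eq_false ho
    simp [this]

/-- The same in `ℝ`. [folklore] -/
theorem pr_shadow_true (M : OracleAdversary Bool) (O : Oracle) (w : List Bool) :
    (M.shadow O).pr id w {true} = (M.outputPMF O w (some true)).toReal := by
  rw [RandAlg.pr, PMF.toOuterMeasure_apply_singleton, outputPMF_shadow_apply_true]

/-- **The acceptance law of the shadow on an ensemble**: `acceptPMF (M.shadow O) n X true` is the
probability that `M^O` outputs `1` on `⟨1ⁿ, s⟩`, `s ← X`. [cite: Goldreich2001, Def. 3.2.2 with §3.6 Def. 3.6.4] -/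
theorem acceptPMF_shadow_true (M : OracleAdversary Bool) (O : Oracle) (n : ℕ) (X : PMF (List Bool)) :
    acceptPMF (M.shadow O) n X true =
      (X.bind fun s => M.outputPMF O (boolPair (unaryEncodeNat n) s)) (some true) := by
  rw [acceptPMF, PMF.bind_apply, PMF.bind_apply]
  refine tsum_congr fun s => ?_
  rw [outputPMF_shadow_apply_true]

/-- **The distinguishing gap of the shadow is the distinguishing gap of `M^O`** between the `n`-th
distributions of two ensembles. [cite: Goldreich2001, Def. 3.2.2] -/
theorem distAdvantage_shadow (M : OracleAdversary Bool) (O : Oracle) (X Y : Ensemble (List Bool)) (n : ℕ) :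
    distAdvantage (M.shadow O) X Y n =
      |(((X n).bind fun s => M.outputPMF O (boolPair (unaryEncodeNat n) s)) (some true)).toReal -
        (((Y n).bind fun s => M.outputPMF O (boolPair (unaryEncodeNat n) s)) (some true)).toReal| := by
  rw [distAdvantage, acceptPMF_shadow_true, acceptPMF_shadow_true]

end OracleAdversary

end Literature.Computability.Cryptography

end
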